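import Mathlib
import HarnessLib

/-!
# Crux `PercNearOneGluing.NearOneGluing` (stmt-CriticalPhenomena-4574), line `SketchR2I5` — the LAMINAR THEOREM (abstract form)

Lead prover-line-stmt-CriticalPhenomena-4574-c2-0, 2026-08-16.  Lands with `--supports stmt-CriticalPhenomena-4574`.

Purely combinatorial/real statement behind Cruxes/NearOneGluing/NOTES.md §C.5: the bad mass that a would-be counterexample to
Kozma–Nitzan's Conjecture 3 can place on any LAMINAR family of relay footprints is small.  Abstract data: a finite ground set `A`
(the relays), a mass `m S ≥ 0` on subsets (`m S` = `P(C(o) ∩ A = S, o ↮ b)`), `bad = Σ_{∅≠S⊆A} m S`, block mass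
`e B = Σ_{∅≠S⊆B} m S` (= `P(o ↮ b, ∅ ≠ C(o) ∩ A ⊆ B)`), and two `|A|`-free budgets that ARE percolation theorems:
* (T1, accumulation) `Σ_{S∋a} m S ≤ δ` for every relay `a` (the event lies in `{a ↮ b}`);
* (T2, exclusivity, landed `exclusivity` p112977 in gluing form) for every family of pairwise disjoint nonempty blocks `B_i ⊆ A`
  with `e B_i ≤ η`:  `Σ_i e B_i ≤ Λ (3δ + η)`  (`Λ ≍ log(1/δ)`).
Conclusion (`laminar_mass_le`): for every laminar family `𝓛` (any two members disjoint or nested) of nonempty subsets of `A`,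
  `Σ_{S∈𝓛} m S ≤ 2 √(δ · bad · Λ) + 3 δ Λ`.
Hence a footprint law supported on a laminar family has `bad ≤ 9 δ Λ`; in a counterexample at `(ε, δ)` only a fraction
`O(√(δΛ/ε))` of the bad mass sits on any laminar family — footprints must be essentially crossing (the binary-tree / nested-rooms /
petal enemies of the crux notes §B are excluded by BHK alone).
Proof: threshold `τ`; HEAVY members (`e S > τ`) each contain a minimal heavy member, minimal heavy members are pairwise disjoint so
their number `q` has `q τ ≤ Σ e(S_i) ≤ bad`, and by (T1) through one relay of each minimal heavy member the heavy mass is `≤ q δ`;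
LIGHT members each lie in a maximal light member, maximal light members are pairwise disjoint blocks with `e ≤ τ`, so by (T2) the
light mass is `≤ Λ(3δ + τ)`; take `τ = √(δ · bad / Λ)`.
-/

namespace Summit.CriticalPhenomena.PercolationContinuityZ3.Theorems

open scoped BigOperators
open Finset

section Laminar

variable {α : Type*} [DecidableEq α]

/-- In a finite family, below every member there is a ⊆-minimal member. [folklore] -/
theorem exists_minimal_mem_subset (F : Finset (Finset α)) {S : Finset α} (hS : S ∈ F) :
    ∃ S₀ ∈ F, S₀ ⊆ S ∧ ∀ T ∈ F, T ⊆ S₀ → T = S₀ := by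
  classical
  have hne : (F.filter fun T => T ⊆ S).Nonempty := ⟨S, mem_filter.2 ⟨hS, Subset.refl S⟩⟩
  obtain ⟨S₀, hS₀, hmin⟩ := exists_min_image (F.filter fun T => T ⊆ S) Finset.card hne
  refine ⟨S₀, (mem_filter.1 hS₀).1, (mem_filter.1 hS₀).2, fun T hT hTS₀ => ?_⟩
  have hT' : T ∈ F.filter fun T => T ⊆ S := mem_filter.2 ⟨hT, hTS₀.trans (mem_filter.1 hS₀).2⟩
  exact eq_of_subset_of_card_le hTS₀ (hmin T hT')

/-- In a finite family, above every member there is a ⊆-maximal member. [folklore] -/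
theorem exists_maximal_mem_superset (F : Finset (Finset α)) {S : Finset α} (hS : S ∈ F) :
    ∃ T ∈ F, S ⊆ T ∧ ∀ T' ∈ F, T ⊆ T' → T' = T := by
  classical
  have hne : (F.filter fun T => S ⊆ T).Nonempty := ⟨S, mem_filter.2 ⟨hS, Subset.refl S⟩⟩
  obtain ⟨T, hT, hmax⟩ := exists_max_image (F.filter fun T => S ⊆ T) Finset.card hne
  refine ⟨T, (mem_filter.1 hT).1, (mem_filter.1 hT).2, fun T' hT' hTT' => ?_⟩
  have hT'' : T' ∈ F.filter fun T => S ⊆ T := mem_filter.2 ⟨hT', (mem_filter.1 hT).2.trans hTT'⟩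
  exact (eq_of_subset_of_card_le hTT' (hmax T' hT'')).symm

/-- **The laminar theorem (abstract form).**  See the module docstring: masses `m ≥ 0` on subsets of a finite ground set `A`
with the accumulation budget (T1) `Σ_{S∋a} m S ≤ δ` and the exclusivity budget (T2) `Σ_i e B_i ≤ Λ (3δ + η)` for pairwise
disjoint nonempty blocks with `e B_i ≤ η` put at most `2√(δ·bad·Λ) + 3δΛ` on any laminar family of nonempty subsets of `A`.
[cite: KozmaNitzan2024, Conj. 3 p.15 (context); VandenbergHaggstromKahn2005, Thm 1.1 (source of T2)] -/
theorem laminar_mass_le (A : Finset α) (m : Finset α → ℝ) (hm0 : ∀ S, 0 ≤ m S) (δ Λ : ℝ) (hδ : 0 ≤ δ) (hΛ : 0 < Λ)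
    (hT1 : ∀ a ∈ A, ∑ S ∈ A.powerset.filter (fun S => a ∈ S), m S ≤ δ)
    (hT2 : ∀ (ℬ : Finset (Finset α)) (η : ℝ), 0 ≤ η → (∀ B ∈ ℬ, B ⊆ A ∧ B.Nonempty) →
      (∀ B ∈ ℬ, ∀ B' ∈ ℬ, B ≠ B' → Disjoint B B') →
      (∀ B ∈ ℬ, ∑ S ∈ A.powerset.filter (fun S => S.Nonempty ∧ S ⊆ B), m S ≤ η) →
      ∑ B ∈ ℬ, ∑ S ∈ A.powerset.filter (fun S => S.Nonempty ∧ S ⊆ B), m S ≤ Λ * (3 * δ + η))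
    (𝓛 : Finset (Finset α)) (h𝓛A : ∀ S ∈ 𝓛, S ⊆ A ∧ S.Nonempty)
    (hlam : ∀ S ∈ 𝓛, ∀ T ∈ 𝓛, Disjoint S T ∨ S ⊆ T ∨ T ⊆ S) :
    ∑ S ∈ 𝓛, m S ≤
      2 * Real.sqrt (δ * (∑ S ∈ A.powerset.filter (fun S => S.Nonempty), m S) * Λ) + 3 * δ * Λ := by
  classical
  -- notation
  set bad : ℝ := ∑ S ∈ A.powerset.filter (fun S => S.Nonempty), m S with hbad
  let e : Finset α → ℝ := fun B => ∑ S ∈ A.powerset.filter (fun S => S.Nonempty ∧ S ⊆ B), m S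
  have he0 : ∀ B, 0 ≤ e B := fun B => sum_nonneg fun S _ => hm0 S
  have hbad0 : 0 ≤ bad := sum_nonneg fun S _ => hm0 S
  have hmS_le_e : ∀ B, ∀ S ∈ 𝓛, S ⊆ B → m S ≤ e B := by
    intro B S hS hSB
    have hmem : S ∈ A.powerset.filter (fun S => S.Nonempty ∧ S ⊆ B) :=
      mem_filter.2 ⟨mem_powerset.2 (h𝓛A S hS).1, (h𝓛A S hS).2, hSB⟩
    exact single_le_sum (fun T _ => hm0 T) hmem
  -- 𝓛-mass is at most bad (used in the degenerate case and for sanity)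
  have h𝓛_sub : 𝓛 ⊆ A.powerset.filter (fun S => S.Nonempty) := fun S hS =>
    mem_filter.2 ⟨mem_powerset.2 (h𝓛A S hS).1, (h𝓛A S hS).2⟩
  have h𝓛_le_bad : ∑ S ∈ 𝓛, m S ≤ bad := sum_le_sum_of_subset_of_nonneg h𝓛_sub fun S _ _ => hm0 S
  -- the threshold
  set τ : ℝ := Real.sqrt (δ * bad / Λ) with hτ
  have hτ0 : 0 ≤ τ := Real.sqrt_nonneg _
  have hτsq : τ * τ = δ * bad / Λ := Real.mul_self_sqrt (div_nonneg (mul_nonneg hδ hbad0) hΛ.le)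
  have hΛτ : Λ * τ = Real.sqrt (δ * bad * Λ) := by
    have h1 : Λ * τ = Real.sqrt (Λ ^ 2 * (δ * bad / Λ)) := by
      rw [Real.sqrt_mul (sq_nonneg Λ), Real.sqrt_sq hΛ.le]
    rw [h1]
    congr 1
    field_simp
  -- heavy / light split
  let heavy := 𝓛.filter fun S => τ < e S
  let light := 𝓛.filter fun S => e S ≤ τ
  have hsplit : ∑ S ∈ 𝓛, m S = ∑ S ∈ heavy, m S + ∑ S ∈ light, m S := by
    have h := (sum_filter_add_sum_filter_not 𝓛 (fun S => τ < e S) (fun S => m S)).symm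
    have h2 : 𝓛.filter (fun S => ¬ τ < e S) = light := by
      ext S; simp only [light, mem_filter, not_lt]
    rw [h2] at h
    exact h
  ------------------------------------------------------------------
  -- HEAVY PART ≤ √(δ bad Λ)
  ------------------------------------------------------------------
  let Hmin := heavy.filter fun S => ∀ T ∈ heavy, T ⊆ S → T = S
  have hHmin_heavy : ∀ S ∈ Hmin, S ∈ heavy := fun S hS => (mem_filter.1 hS).1
  have hheavy_𝓛 : ∀ S ∈ heavy, S ∈ 𝓛 := fun S hS => (mem_filter.1 hS).1
  -- every heavy member contains a minimal heavy member
  have hcover : ∀ S ∈ heavy, ∃ S₀ ∈ Hmin, S₀ ⊆ S := by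
    intro S hS
    obtain ⟨S₀, hS₀, hS₀S, hminimal⟩ := exists_minimal_mem_subset heavy hS
    exact ⟨S₀, mem_filter.2 ⟨hS₀, hminimal⟩, hS₀S⟩
  -- minimal heavy members are pairwise disjoint
  have hHmin_disj : ∀ S ∈ Hmin, ∀ T ∈ Hmin, S ≠ T → Disjoint S T := by
    intro S hS T hT hne
    rcases hlam S (hheavy_𝓛 S (hHmin_heavy S hS)) T (hheavy_𝓛 T (hHmin_heavy T hT)) with h | h | h
    · exact h
    · exact absurd ((mem_filter.1 hT).2 S (hHmin_heavy S hS) h) hne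
    · exact absurd ((mem_filter.1 hS).2 T (hHmin_heavy T hT) h).symm hne
  -- (a) heavy mass ≤ (#Hmin) · δ
  have hheavy_le : ∑ S ∈ heavy, m S ≤ (Hmin.card : ℝ) * δ := by
    -- each heavy S is counted at least once in Σ_{S₀ ∈ Hmin} Σ_{S ∈ heavy, S₀ ⊆ S}
    have h1 : ∑ S ∈ heavy, m S ≤ ∑ S ∈ heavy, ∑ S₀ ∈ Hmin.filter (fun S₀ => S₀ ⊆ S), m S := by
      refine sum_le_sum fun S hS => ?_
      obtain ⟨S₀, hS₀, hS₀S⟩ := hcover S hS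
      have hmem : S₀ ∈ Hmin.filter fun S₀ => S₀ ⊆ S := mem_filter.2 ⟨hS₀, hS₀S⟩
      calc m S = ∑ _S₀ ∈ ({S₀} : Finset (Finset α)), m S := by simp
        _ ≤ ∑ S₀ ∈ Hmin.filter (fun S₀ => S₀ ⊆ S), m S :=
            sum_le_sum_of_subset_of_nonneg (singleton_subset_iff.2 hmem) fun _ _ _ => hm0 S
    have h2 : ∑ S ∈ heavy, ∑ S₀ ∈ Hmin.filter (fun S₀ => S₀ ⊆ S), m S =
        ∑ S₀ ∈ Hmin, ∑ S ∈ heavy.filter (fun S => S₀ ⊆ S), m S := by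
      rw [sum_comm' (t' := Hmin) (s' := fun S₀ => heavy.filter fun S => S₀ ⊆ S)]
      intro S S₀
      simp only [mem_filter]
      tauto
    have h3 : ∀ S₀ ∈ Hmin, ∑ S ∈ heavy.filter (fun S => S₀ ⊆ S), m S ≤ δ := by
      intro S₀ hS₀
      obtain ⟨a, ha⟩ := (h𝓛A S₀ (hheavy_𝓛 S₀ (hHmin_heavy S₀ hS₀))).2
      have haA : a ∈ A := (h𝓛A S₀ (hheavy_𝓛 S₀ (hHmin_heavy S₀ hS₀))).1 ha
      have hsub : heavy.filter (fun S => S₀ ⊆ S) ⊆ A.powerset.filter (fun S => a ∈ S) := by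
        intro S hS
        have hS' := mem_filter.1 hS
        exact mem_filter.2 ⟨mem_powerset.2 (h𝓛A S (hheavy_𝓛 S hS'.1)).1, hS'.2 ha⟩
      exact (sum_le_sum_of_subset_of_nonneg hsub fun S _ _ => hm0 S).trans (hT1 a haA)
    calc ∑ S ∈ heavy, m S ≤ ∑ S₀ ∈ Hmin, ∑ S ∈ heavy.filter (fun S => S₀ ⊆ S), m S := h1.trans h2.le
      _ ≤ ∑ _S₀ ∈ Hmin, δ := sum_le_sum h3
      _ = (Hmin.card : ℝ) * δ := by rw [sum_const, nsmul_eq_mul]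
  -- (b) (#Hmin) · τ ≤ bad
  have hcard_le : (Hmin.card : ℝ) * τ ≤ bad := by
    have h1 : (Hmin.card : ℝ) * τ ≤ ∑ S₀ ∈ Hmin, e S₀ := by
      have : ∑ _S₀ ∈ Hmin, τ ≤ ∑ S₀ ∈ Hmin, e S₀ :=
        sum_le_sum fun S₀ hS₀ => (mem_filter.1 (hHmin_heavy S₀ hS₀)).2.le
      rwa [sum_const, nsmul_eq_mul] at this
    -- the index families {∅ ≠ S ⊆ S₀} are pairwise disjoint for disjoint S₀
    have h2 : ∑ S₀ ∈ Hmin, e S₀ =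
        ∑ S ∈ Hmin.biUnion (fun S₀ => A.powerset.filter (fun S => S.Nonempty ∧ S ⊆ S₀)), m S := by
      rw [sum_biUnion]
      intro S₀ hS₀ T₀ hT₀ hne
      rw [Function.onFun, disjoint_left]
      intro S hS hS'
      have h1' := (mem_filter.1 hS).2
      have h2' := (mem_filter.1 hS').2
      obtain ⟨x, hx⟩ := h1'.1
      exact disjoint_left.1 (hHmin_disj S₀ hS₀ T₀ hT₀ hne) (h1'.2 hx) (h2'.2 hx)
    have h3 : Hmin.biUnion (fun S₀ => A.powerset.filter (fun S => S.Nonempty ∧ S ⊆ S₀)) ⊆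
        A.powerset.filter (fun S => S.Nonempty) := by
      intro S hS
      simp only [mem_biUnion, mem_filter] at hS
      obtain ⟨S₀, _, hSA, hSne, _⟩ := hS
      exact mem_filter.2 ⟨hSA, hSne⟩
    calc (Hmin.card : ℝ) * τ ≤ ∑ S₀ ∈ Hmin, e S₀ := h1
      _ = _ := h2
      _ ≤ bad := sum_le_sum_of_subset_of_nonneg h3 fun S _ _ => hm0 S
  have hheavy_final : ∑ S ∈ heavy, m S ≤ Real.sqrt (δ * bad * Λ) := by
    -- (#Hmin δ) τ ≤ δ bad  and  τ² = δ bad / Λ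
    by_cases hτpos : 0 < τ
    · have h1 : (∑ S ∈ heavy, m S) * τ ≤ δ * bad := by
        calc (∑ S ∈ heavy, m S) * τ ≤ ((Hmin.card : ℝ) * δ) * τ :=
              mul_le_mul_of_nonneg_right hheavy_le hτ0
          _ = δ * ((Hmin.card : ℝ) * τ) := by ring
          _ ≤ δ * bad := mul_le_mul_of_nonneg_left hcard_le hδ
      -- δ bad = τ² Λ = τ · √(δ bad Λ)
      have h2 : δ * bad = τ * Real.sqrt (δ * bad * Λ) := by
        rw [← hΛτ]
        calc δ * bad = (δ * bad / Λ) * Λ := by field_simp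
          _ = τ * τ * Λ := by rw [hτsq]
          _ = τ * (Λ * τ) := by ring
      rw [h2] at h1
      have h3 : (∑ S ∈ heavy, m S) * τ ≤ Real.sqrt (δ * bad * Λ) * τ := by linarith
      exact le_of_mul_le_mul_right h3 hτpos
    · -- τ = 0: then δ * bad = 0, so every heavy chain carries mass ≤ 0 … simplest: heavy mass ≤ #Hmin·δ and #Hmin·0 ≤ bad is
      -- useless; instead use (Σ heavy) τ ≤ δ bad with τ = 0 gives nothing — argue directly: δ bad / Λ = 0.
      have hτ0' : τ = 0 := le_antisymm (not_lt.1 hτpos) hτ0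
      have hdb : δ * bad = 0 := by
        have : δ * bad / Λ = 0 := by rw [← hτsq, hτ0']; ring
        rcases div_eq_zero_iff.1 this with h | h
        · exact h
        · exact absurd h hΛ.ne'
      rcases mul_eq_zero.1 hdb with hδ0 | hb0
      · -- δ = 0: T1 forces every mass through a relay to vanish, so heavy mass ≤ #Hmin · 0 = 0
        have : ∑ S ∈ heavy, m S ≤ 0 := by simpa [hδ0] using hheavy_le
        exact this.trans (Real.sqrt_nonneg _)
      · -- bad = 0: all masses vanish
        have hle : ∑ S ∈ heavy, m S ≤ bad :=
          (sum_le_sum_of_subset_of_nonneg (filter_subset _ _) fun S _ _ => hm0 S).trans h𝓛_le_bad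
        rw [hb0] at hle
        exact hle.trans (Real.sqrt_nonneg _)
  ------------------------------------------------------------------
  -- LIGHT PART ≤ Λ (3δ + τ)
  ------------------------------------------------------------------
  let Lmax := light.filter fun S => ∀ T ∈ light, S ⊆ T → T = S
  have hLmax_light : ∀ S ∈ Lmax, S ∈ light := fun S hS => (mem_filter.1 hS).1
  have hlight_𝓛 : ∀ S ∈ light, S ∈ 𝓛 := fun S hS => (mem_filter.1 hS).1
  have hcover' : ∀ S ∈ light, ∃ T ∈ Lmax, S ⊆ T := by
    intro S hS
    obtain ⟨T, hT, hST, hmaximal⟩ := exists_maximal_mem_superset light hS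
    exact ⟨T, mem_filter.2 ⟨hT, hmaximal⟩, hST⟩
  have hLmax_disj : ∀ S ∈ Lmax, ∀ T ∈ Lmax, S ≠ T → Disjoint S T := by
    intro S hS T hT hne
    rcases hlam S (hlight_𝓛 S (hLmax_light S hS)) T (hlight_𝓛 T (hLmax_light T hT)) with h | h | h
    · exact h
    · exact absurd ((mem_filter.1 hS).2 T (hLmax_light T hT) h).symm hne
    · exact absurd ((mem_filter.1 hT).2 S (hLmax_light S hS) h) hne
  have hlight_le : ∑ S ∈ light, m S ≤ ∑ T ∈ Lmax, e T := by
    have h1 : ∑ S ∈ light, m S ≤ ∑ S ∈ light, ∑ T ∈ Lmax.filter (fun T => S ⊆ T), m S := by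
      refine sum_le_sum fun S hS => ?_
      obtain ⟨T, hT, hST⟩ := hcover' S hS
      have hmem : T ∈ Lmax.filter fun T => S ⊆ T := mem_filter.2 ⟨hT, hST⟩
      calc m S = ∑ _T ∈ ({T} : Finset (Finset α)), m S := by simp
        _ ≤ ∑ T ∈ Lmax.filter (fun T => S ⊆ T), m S :=
            sum_le_sum_of_subset_of_nonneg (singleton_subset_iff.2 hmem) fun _ _ _ => hm0 S
    have h2 : ∑ S ∈ light, ∑ T ∈ Lmax.filter (fun T => S ⊆ T), m S =
        ∑ T ∈ Lmax, ∑ S ∈ light.filter (fun S => S ⊆ T), m S := by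
      rw [sum_comm' (t' := Lmax) (s' := fun T => light.filter fun S => S ⊆ T)]
      intro S T
      simp only [mem_filter]
      tauto
    have h3 : ∀ T ∈ Lmax, ∑ S ∈ light.filter (fun S => S ⊆ T), m S ≤ e T := by
      intro T _
      refine sum_le_sum_of_subset_of_nonneg (fun S hS => ?_) fun S _ _ => hm0 S
      have hS' := mem_filter.1 hS
      exact mem_filter.2 ⟨mem_powerset.2 (h𝓛A S (hlight_𝓛 S hS'.1)).1, (h𝓛A S (hlight_𝓛 S hS'.1)).2, hS'.2⟩
    calc ∑ S ∈ light, m S ≤ ∑ T ∈ Lmax, ∑ S ∈ light.filter (fun S => S ⊆ T), m S := h1.trans h2.le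
      _ ≤ ∑ T ∈ Lmax, e T := sum_le_sum h3
  have hlight_final : ∑ S ∈ light, m S ≤ Λ * (3 * δ + τ) := by
    refine hlight_le.trans (hT2 Lmax τ hτ0 (fun B hB => h𝓛A B (hlight_𝓛 B (hLmax_light B hB))) hLmax_disj
      fun B hB => ?_)
    exact (mem_filter.1 (hLmax_light B hB)).2
  ------------------------------------------------------------------
  -- assemble
  ------------------------------------------------------------------
  calc ∑ S ∈ 𝓛, m S = ∑ S ∈ heavy, m S + ∑ S ∈ light, m S := hsplit
    _ ≤ Real.sqrt (δ * bad * Λ) + Λ * (3 * δ + τ) := add_le_add hheavy_final hlight_final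
    _ = 2 * Real.sqrt (δ * bad * Λ) + 3 * δ * Λ := by rw [mul_add, hΛτ]; ring

/-- **The laminar theorem, registered form** (ground set of relays `A ⊆ Fin n`; see `laminar_mass_le` and the module docstring).
[cite: KozmaNitzan2024, Conj. 3 p.15 (context); VandenbergHaggstromKahn2005, Thm 1.1 (source of T2)] -/
theorem laminarMass : ∀ (n : ℕ) (A : Finset (Fin n)) (m : Finset (Fin n) → ℝ), (∀ S, 0 ≤ m S) → ∀ (δ Λ : ℝ), 0 ≤ δ → 0 < Λ → (∀ a ∈ A, ∑ S ∈ A.powerset.filter (fun S => a ∈ S), m S ≤ δ) → (∀ (ℬ : Finset (Finset (Fin n))) (η : ℝ), 0 ≤ η → (∀ B ∈ ℬ, B ⊆ A ∧ B.Nonempty) → (∀ B ∈ ℬ, ∀ B' ∈ ℬ, B ≠ B' → Disjoint B B') → (∀ B ∈ ℬ, ∑ S ∈ A.powerset.filter (fun S => S.Nonempty ∧ S ⊆ B), m S ≤ η) → ∑ B ∈ ℬ, ∑ S ∈ A.powerset.filter (fun S => S.Nonempty ∧ S ⊆ B), m S ≤ Λ * (3 * δ + η)) → ∀ (𝓛 :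 Finset (Finset (Fin n))), (∀ S ∈ 𝓛, S ⊆ A ∧ S.Nonempty) → (∀ S ∈ 𝓛, ∀ T ∈ 𝓛, Disjoint S T ∨ S ⊆ T ∨ T ⊆ S) → ∑ S ∈ 𝓛, m S ≤ 2 * Real.sqrt (δ * (∑ S ∈ A.powerset.filter (fun S => S.Nonempty), m S) * Λ) + 3 * δ * Λ :=
  fun _ A m hm0 δ Λ hδ hΛ hT1 hT2 𝓛 h𝓛A hlam => laminar_mass_le A m hm0 δ Λ hδ hΛ hT1 hT2 𝓛 h𝓛A hlam

end Laminar

end Summit.CriticalPhenomena.PercolationContinuityZ3.Theorems
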